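import Summits.Ventures.HodgeRepro2.T5CongruenceOrbitFinite

/-!
# The spherical Hecke algebra of `GL_n` over a local field is commutative — in kernel

Tier-5 kernel support (blind cell pub-hodge-repro2, seat p8, gen 11). The last input of the
chain T5-99 → T5-104 — `(Q)`: `R ⧸ (c)` is finite for every `c ≠ 0` — holds for a discrete
valuation ring with finite residue field (the record's `𝒪_v`): every non-zero ideal is a power
of the maximal ideal (`IsDiscreteValuationRing.ideal_eq_span_pow_irreducible`) and Mathlib's
`IsLocalRing.finite_quotient_iff` gives the finiteness of `R ⧸ 𝔪^n` from that of `R ⧸ 𝔪`.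

* `finite_quotient_span_singleton` — `(Q)` for a DVR with finite residue field;
* `hasFiniteQuotients` — the same packaged as Mathlib's `Ring.HasFiniteQuotients R` (a theorem,
  not an instance);
* `heckeAlgebra_mul_comm` — **`H(GL_n(F), GL_n(R))` is commutative for `R` a discrete valuation
  ring with finite residue field and `F` its fraction field**, with no remaining hypothesis:
  the «commutativity of H(G, K) for hyperspecial K (Satake)» cell of CHECK-N3 §17.1 row 5 in
  kernel form at the split places `GL_n(F_v)`, `K = GL_n(𝒪_v)`.

Hypotheses as stated in the kernel: `R` a commutative domain with `[IsDiscreteValuationRing R]`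
and `[Finite (IsLocalRing.ResidueField R)]`; `F` a field with `[Algebra R F] [IsFractionRing R F]`;
`ι` a finite type with decidable equality; `k` the coefficient field of the Hecke algebra.
What stays prose: that `𝒪_v` of the record is such a ring (a non-archimedean local field has
finite residue field) and that `GL_n(𝒪_v)` is the hyperspecial `K` of the record at the split
places; the inert places (unitary groups) are not covered by this chain.
-/

namespace Summit.Ventures.HodgeRepro2.T5DvrFiniteQuotients

variable {R : Type*} [CommRing R] [IsDomain R] [IsDiscreteValuationRing R]

/-- `(Q)` for a discrete valuation ring with finite residue field: every non-zero principal
quotient `R ⧸ (c)` is finite. -/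
theorem finite_quotient_span_singleton [Finite (IsLocalRing.ResidueField R)] (c : R)
    (hc : c ≠ 0) : Finite (R ⧸ Ideal.span {c}) := by
  obtain ⟨ϖ, hϖ⟩ := IsDiscreteValuationRing.exists_irreducible R
  have hne : Ideal.span {c} ≠ ⊥ := by
    rw [Ne, Ideal.span_singleton_eq_bot]
    exact hc
  obtain ⟨n, hn⟩ := IsDiscreteValuationRing.ideal_eq_span_pow_irreducible hne hϖ
  rw [IsLocalRing.finite_quotient_iff]
  refine ⟨n, ?_⟩
  rw [hϖ.maximalIdeal_eq, Ideal.span_singleton_pow, hn]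

/-- A discrete valuation ring with finite residue field has finite quotients in Mathlib's sense
(`Ring.HasFiniteQuotients`): every non-zero ideal is principal. -/
theorem hasFiniteQuotients [Finite (IsLocalRing.ResidueField R)] : Ring.HasFiniteQuotients R where
  finiteQuotient := by
    intro I hI
    obtain ⟨c, hc⟩ := (IsPrincipalIdealRing.principal I).principal
    have hc0 : c ≠ 0 := by
      rintro rfl
      apply hI
      rw [hc, Submodule.span_singleton_eq_bot]
    rw [hc]
    exact finite_quotient_span_singleton c hc0

variable {F : Type*} [Field F] [Algebra R F] [IsFractionRing R F]
variable {ι : Type*} [Fintype ι] [DecidableEq ι]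

/-- **The spherical Hecke algebra `H(GL_n(F), GL_n(R))` is commutative** for `R` a discrete
valuation ring with finite residue field and `F` its fraction field — Gelfand's trick with the
transpose (T5-84 + T5-101), the Cartan decomposition (T5-99 + T5-100), the finiteness of the
double cosets (T5-102 → T5-104) and `finite_quotient_span_singleton`. -/
theorem heckeAlgebra_mul_comm [Finite (IsLocalRing.ResidueField R)] (k : Type*) [Field k]
    (T S : T5HeckePermutationModule.heckeAlgebra k
      (Matrix.GeneralLinearGroup.map (n := ι) (algebraMap R F)).range) :
    T * S = S * T :=
  T5CongruenceOrbitFinite.heckeAlgebra_mul_comm_of_finite_quotients k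
    (fun c hc => finite_quotient_span_singleton c hc) T S

end Summit.Ventures.HodgeRepro2.T5DvrFiniteQuotients
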